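import Mathlib.Analysis.SpecialFunctions.ExpDeriv
import Mathlib.Analysis.SpecialFunctions.Pow.Real
import Mathlib.Analysis.Calculus.ContDiff.Deriv
import Mathlib.Analysis.Calculus.Deriv.Inv
import Mathlib.Analysis.Calculus.Deriv.Pow
import Mathlib.Analysis.Calculus.MeanValue
import Mathlib.Analysis.Complex.RealDeriv
import Mathlib.MeasureTheory.Integral.IntervalIntegral.FundThmCalculus
import Mathlib.MeasureTheory.Integral.IntervalIntegral.IntegrationByParts
import HarnessLib

/-!
# The scalar complex Riccati equation of a hyperbolic Gaussian beam and its transport equation: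
# explicit global solutions

(infrastructure for the Gaussian-beam input `SbierskiKerrTrappedGeodesicBeams` of
`Literature/Barriers/FinalStateConjecture/TrappingDerivativeLossBeams.lean`; namespace
`Literature.Analysis.ODE`)

In the construction of a Gaussian beam `a e^{iλφ}` along a null geodesic `γ` (Ralston 1982;
Sbierski, Anal. PDE 8 (2015), §3 = arXiv:1311.2477, §2.2) the Hessian `M(s)` of the phase along
`γ` solves the matrix Riccati equation `0 = A + BM + MBᵀ + MCM + Ṁ` ((2.20) of the arXiv text),
globally, with `Im M` positive definite transversally, and the amplitude solves the linear
transport ODE `2 grad φ(a) + □φ · a = 0` ((2.15)). When `γ` is the orbit of a Killing field and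
the transversal directions decouple (the equatorial photon orbits of Kerr), each transversal
direction carries a *scalar* Riccati equation with *constant real* coefficients,
`τ ẇ + α + 2β w + γ w² = 0` (`τ = ṫ > 0` the rate of the time function, `γ > 0`), for a complex
unknown `w` with `Im w > 0`, and in the unstable direction the equation is hyperbolic:
`D = β² − αγ > 0`. This file solves that equation in closed form and records what the beam
construction uses:

* `riccatiSol τ α β γ w₀ t = (w₊ − w₋ z₀ e^{−Λt}) / (1 − z₀ e^{−Λt})`, `w± = (−β ± √D)/γ` the
  real equilibria, `Λ = 2√D/τ`, `z₀ = (w₀ − w₊)/(w₀ − w₋)` (the Möbius/cross-ratio solution): for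
  `Im w₀ > 0` it is defined for all `t` (`riccati_denom_ne_zero`), smooth
  (`contDiff_riccatiSol`), solves the equation (`hasDerivAt_riccatiSol`) with `riccatiSol … 0 = w₀`,
  and keeps `Im w(t) > 0` for all `t` (`im_riccatiSol_pos` — Sbierski's "`Im M(s)` stays
  positive definite", here by the explicit formula `Im w = (w₊ − w₋) Im z / |1 − z|²`; `Im w → 0`
  like `e^{−Λt}`: the beam spreads at the Lyapunov rate of the orbit);
* `riccatiAmp τ α β γ w₀ C₀ C₁ t = exp (−∫₀ᵗ (C₀ + C₁ w(s)) ds)`, the solution of the transport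
  equation `ḃ = −(C₀ + C₁ w) b`, `b(0) = 1` (`hasDerivAt_riccatiAmp`), smooth and nowhere zero;
* the **conservation law** behind Sbierski's characterisation of the energy (Thm. 4.1 = arXiv
  Thm. 7, whose proof is the approximate conservation of `λ²|a|² e^{−2λ Im φ} grad Re φ`): if
  `C₁ = γ/(2τ)` and `Re C₀ = β/(2τ)` then `|b(t)|⁴ / Im w(t)` is constant
  (`normSq_riccatiAmp_sq_mul`), i.e. `|b|² ∝ (Im w)^{1/2}`: the squared amplitude times the
  transversal width of the beam is conserved.

Everything is elementary calculus; no statement here refers to Kerr.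

## References

* J. Sbierski, Anal. PDE 8 (2015) 1379–1420, §3 (arXiv:1311.2477, §2.2: (2.15), (2.19)–(2.20),
  the symplectic argument for the invertibility of `J` and the positivity of `Im M`), Thm. 4.1
  (arXiv Thm. 7, proof: the approximate conservation law).
* J. Ralston, *Gaussian beams and the propagation of singularities*, Studies in PDE, MAA Stud.
  Math. 23 (1982) 206–248.
-/

noncomputable section

open Real Complex MeasureTheory intervalIntegral Set
open scoped ContDiff ComplexConjugate

namespace Literature.Analysis.ODE

/-! ### The equilibria and the rate -/

/-- The discriminant `D = β² − αγ` of the scalar Riccati equation `τẇ + α + 2βw + γw² = 0`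
(hyperbolic case `D > 0`). [cite: Sbierski2015, §3 (arXiv §2.2, (2.20))] -/
def riccatiDiscr (α β γ : ℝ) : ℝ :=
  β ^ 2 - α * γ

/-- The larger real equilibrium `w₊ = (−β + √D)/γ` (the attractor for `t → +∞`).
[cite: Sbierski2015, §3 (arXiv §2.2, (2.20))] -/
def riccatiRootPlus (α β γ : ℝ) : ℝ :=
  (-β + √(riccatiDiscr α β γ)) / γ

/-- The smaller real equilibrium `w₋ = (−β − √D)/γ`. [cite: Sbierski2015, §3 (arXiv §2.2, (2.20))] -/
def riccatiRootMinus (α β γ : ℝ) : ℝ :=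
  (-β - √(riccatiDiscr α β γ)) / γ

/-- The rate `Λ = 2√D/τ = γ (w₊ − w₋)/τ` (twice the Lyapunov exponent of the underlying orbit in
the time `t`). [cite: Sbierski2015, §3 (arXiv §2.2, (2.20))] -/
def riccatiRate (τ α β γ : ℝ) : ℝ :=
  2 * √(riccatiDiscr α β γ) / τ

/-- The cross-ratio datum `z₀ = (w₀ − w₊)/(w₀ − w₋)`. [folklore] -/
def riccatiZ (α β γ : ℝ) (w₀ : ℂ) : ℂ :=
  (w₀ - riccatiRootPlus α β γ) / (w₀ - riccatiRootMinus α β γ)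

/-- `z(t) = z₀ e^{−Λt}`, the solution of the linearised equation `ż = −Λ z`. [folklore] -/
def riccatiZt (τ α β γ : ℝ) (w₀ : ℂ) (t : ℝ) : ℂ :=
  riccatiZ α β γ w₀ * ((Real.exp (-(riccatiRate τ α β γ * t)) : ℝ) : ℂ)

/-- **The explicit solution of the scalar complex Riccati equation**
`τẇ + α + 2βw + γw² = 0`, `w(0) = w₀`: `w(t) = (w₊ − w₋ z(t))/(1 − z(t))`, `z(t) = z₀ e^{−Λt}`.
Junk value where `1 − z(t) = 0` (never, if `Im w₀ > 0` and `D > 0`, `riccati_denom_ne_zero`).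
[cite: Sbierski2015, §3 (arXiv §2.2, (2.20))] -/
def riccatiSol (τ α β γ : ℝ) (w₀ : ℂ) (t : ℝ) : ℂ :=
  (riccatiRootPlus α β γ - riccatiRootMinus α β γ * riccatiZt τ α β γ w₀ t) /
    (1 - riccatiZt τ α β γ w₀ t)

section Riccati

variable {τ α β γ : ℝ} {w₀ : ℂ}

/-- `w₊ − w₋ = 2√D/γ > 0` for `D > 0`, `γ > 0`. [folklore] -/
theorem riccatiRootPlus_sub_rootMinus (hγ : γ ≠ 0) :
    riccatiRootPlus α β γ - riccatiRootMinus α β γ = 2 * √(riccatiDiscr α β γ) / γ := by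
  unfold riccatiRootPlus riccatiRootMinus
  field_simp
  ring

/-- `w₊ − w₋ > 0` for `D > 0`, `γ > 0`. [folklore] -/
theorem riccatiRootPlus_sub_rootMinus_pos (hγ : 0 < γ) (hD : 0 < riccatiDiscr α β γ) :
    0 < riccatiRootPlus α β γ - riccatiRootMinus α β γ := by
  rw [riccatiRootPlus_sub_rootMinus hγ.ne']
  have := Real.sqrt_pos.2 hD
  positivity

/-- Vieta: `α + 2βw + γw² = γ (w − w₊)(w − w₋)`. [folklore] -/
theorem riccati_vieta (hγ : γ ≠ 0) (hD : 0 ≤ riccatiDiscr α β γ) (w : ℂ) :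
    (α : ℂ) + 2 * β * w + γ * w ^ 2 =
      γ * (w - riccatiRootPlus α β γ) * (w - riccatiRootMinus α β γ) := by
  have hsq : (√(riccatiDiscr α β γ)) ^ 2 = β ^ 2 - α * γ := Real.sq_sqrt hD
  have hsq' : ((√(riccatiDiscr α β γ) : ℝ) : ℂ) ^ 2 = (β : ℂ) ^ 2 - α * γ := by
    exact_mod_cast hsq
  have hγ' : (γ : ℂ) ≠ 0 := by exact_mod_cast hγ
  have hp : (riccatiRootPlus α β γ : ℂ) = (-(β : ℂ) + (√(riccatiDiscr α β γ) : ℝ)) / γ := by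
    unfold riccatiRootPlus; push_cast; ring
  have hm : (riccatiRootMinus α β γ : ℂ) = (-(β : ℂ) - (√(riccatiDiscr α β γ) : ℝ)) / γ := by
    unfold riccatiRootMinus; push_cast; ring
  rw [hp, hm]
  field_simp
  linear_combination hsq'

/-- A complex number with nonzero imaginary part is not real, in particular `w₀ − w₋ ≠ 0`.
[folklore] -/
theorem sub_real_ne_zero (hw : w₀.im ≠ 0) (x : ℝ) : w₀ - x ≠ 0 := by
  intro h
  have := congrArg Complex.im h
  simp at this
  exact hw this

/-- `Im z₀ = (w₊ − w₋) Im w₀ / |w₀ − w₋|²`. [folklore] -/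
theorem im_riccatiZ (hw : w₀.im ≠ 0) :
    (riccatiZ α β γ w₀).im =
      (riccatiRootPlus α β γ - riccatiRootMinus α β γ) * w₀.im /
        Complex.normSq (w₀ - riccatiRootMinus α β γ) := by
  unfold riccatiZ
  have hne := sub_real_ne_zero hw (riccatiRootMinus α β γ)
  rw [Complex.div_im]
  simp only [Complex.sub_re, Complex.ofReal_re, Complex.sub_im, Complex.ofReal_im, sub_zero]
  field_simp
  ring

/-- `Im z₀ > 0` when `Im w₀ > 0`, `γ > 0`, `D > 0`. [folklore] -/
theorem im_riccatiZ_pos (hγ : 0 < γ) (hD : 0 < riccatiDiscr α β γ) (hw : 0 < w₀.im) :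
    0 < (riccatiZ α β γ w₀).im := by
  rw [im_riccatiZ hw.ne']
  have h1 := riccatiRootPlus_sub_rootMinus_pos hγ hD
  have h2 : 0 < Complex.normSq (w₀ - riccatiRootMinus α β γ) :=
    Complex.normSq_pos.2 (sub_real_ne_zero hw.ne' _)
  positivity

/-- `Im z(t) = e^{−Λt} Im z₀ > 0`. [folklore] -/
theorem im_riccatiZt_pos (hγ : 0 < γ) (hD : 0 < riccatiDiscr α β γ) (hw : 0 < w₀.im) (t : ℝ) :
    0 < (riccatiZt τ α β γ w₀ t).im := by
  unfold riccatiZt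
  rw [Complex.mul_im, Complex.ofReal_re, Complex.ofReal_im, mul_zero, zero_add]
  exact mul_pos (im_riccatiZ_pos hγ hD hw) (Real.exp_pos _)

/-- **The solution never blows up**: `1 − z(t) ≠ 0` for all `t` (its imaginary part is
`−Im z(t) < 0`). This is the scalar shadow of the invertibility of the Jacobi matrix `J(s)` in
Sbierski's construction. [cite: Sbierski2015, §3 (arXiv §2.2, invertibility of J)] -/
theorem riccati_denom_ne_zero (hγ : 0 < γ) (hD : 0 < riccatiDiscr α β γ) (hw : 0 < w₀.im)
    (t : ℝ) : 1 - riccatiZt τ α β γ w₀ t ≠ 0 := by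
  intro h
  have := congrArg Complex.im h
  simp only [Complex.sub_im, Complex.one_im, zero_sub, Complex.zero_im, neg_eq_zero] at this
  exact (im_riccatiZt_pos (τ := τ) hγ hD hw t).ne' this

/-- Initial value: `w(0) = w₀`. [folklore] -/
theorem riccatiSol_zero (hγ : 0 < γ) (hD : 0 < riccatiDiscr α β γ) (hw : 0 < w₀.im) :
    riccatiSol τ α β γ w₀ 0 = w₀ := by
  have hz0 : riccatiZt τ α β γ w₀ 0 = riccatiZ α β γ w₀ := by simp [riccatiZt]
  have hden := riccati_denom_ne_zero (τ := τ) hγ hD hw 0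
  rw [hz0] at hden
  unfold riccatiSol
  rw [hz0, div_eq_iff hden]
  unfold riccatiZ
  have hne := sub_real_ne_zero hw.ne' (riccatiRootMinus α β γ)
  field_simp
  ring

/-- **`Im w(t) = (w₊ − w₋) Im z(t) / |1 − z(t)|²`**. [folklore] -/
theorem im_riccatiSol (t : ℝ) :
    (riccatiSol τ α β γ w₀ t).im =
      (riccatiRootPlus α β γ - riccatiRootMinus α β γ) * (riccatiZt τ α β γ w₀ t).im /
        Complex.normSq (1 - riccatiZt τ α β γ w₀ t) := by
  unfold riccatiSol
  rw [Complex.div_im, div_sub_div_same]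
  congr 1
  simp only [Complex.sub_re, Complex.one_re, Complex.sub_im, Complex.one_im, Complex.mul_re,
    Complex.mul_im, Complex.ofReal_re, Complex.ofReal_im, zero_mul, sub_zero, zero_sub, add_zero]
  ring

/-- **`Im w(t) > 0` for all `t`** (Sbierski: "`Im M(s)` stays positive definite on a three
dimensional subspace transversal to `γ̇(s)`"): the Gaussian shape of the beam never degenerates.
[cite: Sbierski2015, §3 (arXiv §2.2, (2.13) for all s)] -/
theorem im_riccatiSol_pos (hγ : 0 < γ) (hD : 0 < riccatiDiscr α β γ) (hw : 0 < w₀.im) (t : ℝ) :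
    0 < (riccatiSol τ α β γ w₀ t).im := by
  rw [im_riccatiSol t]
  have h1 := riccatiRootPlus_sub_rootMinus_pos hγ hD
  have h2 := im_riccatiZt_pos (τ := τ) hγ hD hw t
  have h3 : 0 < Complex.normSq (1 - riccatiZt τ α β γ w₀ t) :=
    Complex.normSq_pos.2 (riccati_denom_ne_zero hγ hD hw t)
  positivity

/-- `ż = −Λ z`. [folklore] -/
theorem hasDerivAt_riccatiZt (t : ℝ) :
    HasDerivAt (riccatiZt τ α β γ w₀) (-(riccatiRate τ α β γ : ℂ) * riccatiZt τ α β γ w₀ t) t := by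
  unfold riccatiZt
  have h1 : HasDerivAt (fun t : ℝ ↦ Real.exp (-(riccatiRate τ α β γ * t)))
      (Real.exp (-(riccatiRate τ α β γ * t)) * (-(riccatiRate τ α β γ))) t := by
    have := ((hasDerivAt_id t).const_mul (riccatiRate τ α β γ)).neg.exp
    simpa using this
  have h2 := (h1.ofReal_comp).const_mul (riccatiZ α β γ w₀)
  refine h2.congr_deriv ?_
  push_cast
  ring

/-- The solution is smooth. [folklore] -/
theorem contDiff_riccatiSol (hγ : 0 < γ) (hD : 0 < riccatiDiscr α β γ) (hw : 0 < w₀.im) :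
    ContDiff ℝ ∞ (riccatiSol τ α β γ w₀) := by
  have hz : ContDiff ℝ ∞ (riccatiZt τ α β γ w₀) := by
    unfold riccatiZt
    refine contDiff_const.mul ?_
    exact Complex.ofRealCLM.contDiff.comp ((contDiff_const.mul contDiff_id).neg.exp)
  unfold riccatiSol
  simp only [div_eq_mul_inv]
  refine (contDiff_const.sub (contDiff_const.mul hz)).mul ?_
  exact (contDiff_const.sub hz).inv fun t ↦ riccati_denom_ne_zero hγ hD hw t

/-- **The Riccati equation**: `w` satisfies `ẇ = −(α + 2βw + γw²)/τ`, i.e.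
`τẇ + α + 2βw + γw² = 0`, for all `t`. [cite: Sbierski2015, §3 (arXiv §2.2, (2.20))] -/
theorem hasDerivAt_riccatiSol (hτ : τ ≠ 0) (hγ : 0 < γ) (hD : 0 < riccatiDiscr α β γ)
    (hw : 0 < w₀.im) (t : ℝ) :
    HasDerivAt (riccatiSol τ α β γ w₀)
      (-((α : ℂ) + 2 * β * riccatiSol τ α β γ w₀ t + γ * riccatiSol τ α β γ w₀ t ^ 2) / τ) t := by
  have hden := riccati_denom_ne_zero (τ := τ) hγ hD hw t
  have hz := hasDerivAt_riccatiZt (τ := τ) (α := α) (β := β) (γ := γ) (w₀ := w₀) t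
  set z := riccatiZt τ α β γ w₀ t with hz_def
  set wp : ℝ := riccatiRootPlus α β γ with hwp
  set wm : ℝ := riccatiRootMinus α β γ with hwm
  set Λ : ℝ := riccatiRate τ α β γ with hΛ
  have hnum : HasDerivAt (fun s ↦ (wp : ℂ) - wm * riccatiZt τ α β γ w₀ s)
      (-(wm * (-(Λ : ℂ) * z))) t := by
    simpa using (hz.const_mul (wm : ℂ)).const_sub (wp : ℂ)
  have hden' : HasDerivAt (fun s ↦ (1 : ℂ) - riccatiZt τ α β γ w₀ s) (-(-(Λ : ℂ) * z)) t :=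
    hz.const_sub 1
  have h := hnum.div hden' hden
  -- the algebra: both sides equal `−Λ z (w₊ − w₋)/(1 − z)²`
  have hW1 : riccatiSol τ α β γ w₀ t - wp = (wp - wm) * z / (1 - z) := by
    simp only [riccatiSol, ← hz_def, ← hwp, ← hwm]
    field_simp
    ring
  have hW2 : riccatiSol τ α β γ w₀ t - wm = (wp - wm) / (1 - z) := by
    simp only [riccatiSol, ← hz_def, ← hwp, ← hwm]
    field_simp
    ring
  have hτ' : (τ : ℂ) ≠ 0 := by exact_mod_cast hτ
  have hγ' : (γ : ℂ) ≠ 0 := by exact_mod_cast hγ.ne'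
  have hΛ' : (Λ : ℂ) * τ = γ * (wp - wm) := by
    rw [hΛ, hwp, hwm, ← Complex.ofReal_sub, riccatiRootPlus_sub_rootMinus hγ.ne']
    unfold riccatiRate
    push_cast
    field_simp
  have key : (-((wm : ℂ) * (-(Λ : ℂ) * z)) * (1 - riccatiZt τ α β γ w₀ t) -
        ((wp : ℂ) - wm * riccatiZt τ α β γ w₀ t) * -(-(Λ : ℂ) * z)) /
          (1 - riccatiZt τ α β γ w₀ t) ^ 2 =
      -((α : ℂ) + 2 * β * riccatiSol τ α β γ w₀ t + γ * riccatiSol τ α β γ w₀ t ^ 2) / τ := by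
    rw [riccati_vieta hγ.ne' hD.le, mul_assoc, hW1, hW2, ← hz_def]
    have hΛ'' : (Λ : ℂ) = γ * (wp - wm) / τ := by
      rw [← hΛ']; field_simp
    rw [hΛ'']
    field_simp
    ring
  rw [key] at h
  exact h

end Riccati

/-! ### The transport equation -/

/-- **The amplitude**: `b(t) = exp (−∫₀ᵗ (C₀ + C₁ w(s)) ds)`, the solution of the transport
ODE `ḃ = −(C₀ + C₁ w) b`, `b(0) = 1`, along the orbit (Sbierski's (2.15) for structure functions
depending on the time only, with `□φ|_γ` affine in the Hessian `w`).
[cite: Sbierski2015, §3 (arXiv §2.2, (2.15))] -/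
def riccatiAmp (τ α β γ : ℝ) (w₀ C₀ C₁ : ℂ) (t : ℝ) : ℂ :=
  Complex.exp (-∫ s in (0 : ℝ)..t, (C₀ + C₁ * riccatiSol τ α β γ w₀ s))

section Transport

variable {τ α β γ : ℝ} {w₀ C₀ C₁ : ℂ}

/-- `b(0) = 1`. [folklore] -/
@[simp]
theorem riccatiAmp_zero : riccatiAmp τ α β γ w₀ C₀ C₁ 0 = 1 := by
  simp [riccatiAmp]

/-- `b(t) ≠ 0`. [folklore] -/
theorem riccatiAmp_ne_zero (t : ℝ) : riccatiAmp τ α β γ w₀ C₀ C₁ t ≠ 0 :=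
  Complex.exp_ne_zero _

/-- The integrand of the amplitude is continuous. [folklore] -/
theorem continuous_riccati_integrand (hγ : 0 < γ) (hD : 0 < riccatiDiscr α β γ)
    (hw : 0 < w₀.im) : Continuous fun s ↦ C₀ + C₁ * riccatiSol τ α β γ w₀ s :=
  continuous_const.add (continuous_const.mul (contDiff_riccatiSol hγ hD hw).continuous)

/-- The primitive `t ↦ ∫₀ᵗ (C₀ + C₁ w)` has derivative `C₀ + C₁ w(t)`. [folklore] -/
theorem hasDerivAt_riccati_integral (hγ : 0 < γ) (hD : 0 < riccatiDiscr α β γ) (hw : 0 < w₀.im)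
    (t : ℝ) :
    HasDerivAt (fun u ↦ ∫ s in (0 : ℝ)..u, (C₀ + C₁ * riccatiSol τ α β γ w₀ s))
      (C₀ + C₁ * riccatiSol τ α β γ w₀ t) t := by
  have hc := continuous_riccati_integrand (τ := τ) (C₀ := C₀) (C₁ := C₁) hγ hD hw
  exact integral_hasDerivAt_right (hc.intervalIntegrable _ _)
    (hc.stronglyMeasurableAtFilter _ _) hc.continuousAt

/-- **The transport equation**: `ḃ = −(C₀ + C₁ w(t)) b`. [cite: Sbierski2015, §3 (arXiv §2.2, (2.15))] -/
theorem hasDerivAt_riccatiAmp (hγ : 0 < γ) (hD : 0 < riccatiDiscr α β γ) (hw : 0 < w₀.im)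
    (t : ℝ) :
    HasDerivAt (riccatiAmp τ α β γ w₀ C₀ C₁)
      (-(C₀ + C₁ * riccatiSol τ α β γ w₀ t) * riccatiAmp τ α β γ w₀ C₀ C₁ t) t := by
  have h := (hasDerivAt_riccati_integral (τ := τ) (C₀ := C₀) (C₁ := C₁) hγ hD hw t).neg.cexp
  simp only [Pi.neg_apply] at h
  refine h.congr_deriv ?_
  simp only [riccatiAmp]
  ring

/-- The amplitude is smooth (its logarithmic derivative is smooth). [folklore] -/
theorem contDiff_riccatiAmp (hγ : 0 < γ) (hD : 0 < riccatiDiscr α β γ) (hw : 0 < w₀.im) :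
    ContDiff ℝ ∞ (riccatiAmp τ α β γ w₀ C₀ C₁) := by
  have hI : ContDiff ℝ ∞ fun u ↦ ∫ s in (0 : ℝ)..u, (C₀ + C₁ * riccatiSol τ α β γ w₀ s) := by
    rw [contDiff_infty_iff_deriv]
    constructor
    · exact fun t ↦ (hasDerivAt_riccati_integral hγ hD hw t).differentiableAt
    · have : deriv (fun u ↦ ∫ s in (0 : ℝ)..u, (C₀ + C₁ * riccatiSol τ α β γ w₀ s)) =
          fun t ↦ C₀ + C₁ * riccatiSol τ α β γ w₀ t :=
        funext fun t ↦ (hasDerivAt_riccati_integral hγ hD hw t).deriv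
      rw [this]
      exact contDiff_const.add (contDiff_const.mul (contDiff_riccatiSol hγ hD hw))
  unfold riccatiAmp
  exact hI.neg.cexp

/-- **The conservation law of the beam** (the content of Sbierski's approximate conservation of
`λ²|a|² e^{−2λ Im φ} grad Re φ` in the proof of Thm. 4.1, for a beam riding an orbit of a Killing
field): if `C₁ = γ/(2τ)` and `Re C₀ = β/(2τ)`, then `|b(t)|⁴ / Im w(t)` is constant in `t`; with
`b(0) = 1`, `|b(t)|⁴ Im w₀ = Im w(t)`. Indeed `d/dt log |b|² = −2 Re (C₀ + C₁ w) = −(β + γ Re w)/τ`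
while `d/dt log Im w = −2(β + γ Re w)/τ` by the Riccati equation.
[cite: Sbierski2015, Thm. 4.1 (arXiv Thm. 7, proof)] -/
theorem normSq_riccatiAmp_sq_mul (hτ : τ ≠ 0) (hγ : 0 < γ) (hD : 0 < riccatiDiscr α β γ)
    (hw : 0 < w₀.im) (hC₁ : C₁ = (γ / (2 * τ) : ℝ)) (hC₀ : C₀.re = β / (2 * τ)) (t : ℝ) :
    Complex.normSq (riccatiAmp τ α β γ w₀ C₀ C₁ t) ^ 2 * w₀.im =
      (riccatiSol τ α β γ w₀ t).im := by
  -- `Φ(t) = |b|⁴ / Im w` has zero derivative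
  set b := riccatiAmp τ α β γ w₀ C₀ C₁ with hb
  set w := riccatiSol τ α β γ w₀ with hw_def
  have hwpos : ∀ s, 0 < (w s).im := fun s ↦ im_riccatiSol_pos hγ hD hw s
  -- derivative of `|b|²`
  have hQ : ∀ s, HasDerivAt (fun u ↦ Complex.normSq (b u))
      (-(β / τ + γ / τ * (w s).re) * Complex.normSq (b s)) s := by
    intro s
    have hb' := hasDerivAt_riccatiAmp (τ := τ) (C₀ := C₀) (C₁ := C₁) hγ hD hw s
    rw [← hb, ← hw_def] at hb'
    have hre : HasDerivAt (fun u ↦ (b u).re) (-(C₀ + C₁ * w s) * b s).re s := by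
      rw [show (fun u ↦ (b u).re) = Complex.reCLM ∘ b from rfl]
      exact (Complex.reCLM.hasFDerivAt.comp_hasDerivAt s hb').congr_deriv (by simp)
    have him : HasDerivAt (fun u ↦ (b u).im) (-(C₀ + C₁ * w s) * b s).im s := by
      rw [show (fun u ↦ (b u).im) = Complex.imCLM ∘ b from rfl]
      exact (Complex.imCLM.hasFDerivAt.comp_hasDerivAt s hb').congr_deriv (by simp)
    have h := (hre.pow 2).add (him.pow 2)
    have hfun : (fun u ↦ Complex.normSq (b u)) = fun u ↦ (b u).re ^ 2 + (b u).im ^ 2 := by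
      funext u; rw [Complex.normSq_apply]; ring
    rw [hfun]
    refine h.congr_deriv ?_
    rw [hC₁, Complex.normSq_apply]
    simp only [Complex.neg_re, Complex.neg_im, Complex.add_re, Complex.add_im, Complex.mul_re,
      Complex.mul_im, Complex.ofReal_re, Complex.ofReal_im, zero_mul, sub_zero, add_zero, hC₀,
      Nat.cast_ofNat]
    field_simp
    ring
  -- derivative of `Im w`
  have hW : ∀ s, HasDerivAt (fun u ↦ (w u).im)
      (-(2 * β / τ + 2 * γ / τ * (w s).re) * (w s).im) s := by
    intro s
    have hw' := hasDerivAt_riccatiSol (w₀ := w₀) hτ hγ hD hw s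
    rw [← hw_def] at hw'
    have him : HasDerivAt (fun u ↦ (w u).im)
        (-((α : ℂ) + 2 * β * w s + γ * w s ^ 2) / τ).im s := by
      rw [show (fun u ↦ (w u).im) = Complex.imCLM ∘ w from rfl]
      exact (Complex.imCLM.hasFDerivAt.comp_hasDerivAt s hw').congr_deriv (by simp)
    refine him.congr_deriv ?_
    rw [Complex.div_ofReal_im]
    simp only [Complex.neg_im, Complex.add_im, Complex.mul_im, Complex.ofReal_re,
      Complex.ofReal_im, zero_mul, add_zero, Complex.re_ofNat, Complex.im_ofNat, sub_zero,
      zero_add, sq, Complex.mul_re]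
    field_simp
    ring
  -- the quotient has zero derivative
  have hΦ : ∀ s, HasDerivAt (fun u ↦ Complex.normSq (b u) ^ 2 / (w u).im) 0 s := by
    intro s
    have hws := (hwpos s).ne'
    have h := ((hQ s).pow 2).div (hW s) hws
    refine h.congr_deriv ?_
    simp only [Pi.pow_apply]
    field_simp
    ring
  have hconst := is_const_of_deriv_eq_zero (f := fun u ↦ Complex.normSq (b u) ^ 2 / (w u).im)
    (fun s ↦ (hΦ s).differentiableAt) (fun s ↦ (hΦ s).deriv) t 0
  have h0 : Complex.normSq (b 0) ^ 2 / (w 0).im = 1 / w₀.im := by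
    rw [hb, hw_def, riccatiAmp_zero, riccatiSol_zero hγ hD hw]
    simp
  rw [h0] at hconst
  have hwt := (hwpos t).ne'
  field_simp at hconst
  linarith [hconst]

end Transport

end Literature.Analysis.ODE

end
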